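import Literature.Analysis.FluidPDE.SteadyDSolutionDerivativeDecay
import Literature.Analysis.FluidPDE.StokesInteriorEstimateHolds
import Literature.Analysis.FluidPDE.CalderonSplittingLp
import Literature.Analysis.FunctionSpaces.SobolevImbeddingSup
import HarnessLib

/-!
# Uniform decay of steady `D`-solutions on `ℝ³`: discharge of `wang2025_thm21_DSolution_uniformDecay`
# (Galdi 2011, Thm X.5.1 / Wang 2025, Thm 2.1)

Analysis/FluidPDE proofs file (theorems only: no definitions, no named facts): the discharge
`wang2025_thm21_DSolution_uniformDecay_holds` of the named fact of `SteadyDSolutionAsymptotics.lean`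
(W. Wang 2025, Thm 2.1 = G. P. Galdi 2011, Thm X.5.1, with Wang's class hypothesis `u ∈ L⁶`):
for a classical steady solution `(u, p)` of `−Δu + (u·∇)u + ∇p = 0`, `div u = 0` on `ℝ³` with
`∫|∇u|² < ∞` and `u ∈ L⁶(ℝ³)` there is `p₁` with `‖Dⁿu(x)‖ → 0`, `‖Dⁿ(p − p₁)(x)‖ → 0` as
`|x| → ∞` for every `n`.

By the sibling files only the ORDER-ZERO VELOCITY CLAUSE remained:
`wang2025_thm21_DSolution_uniformDecay_of_velocityDecay` (`SteadyDSolutionDerivativeDecay.lean`)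
reduces the fact to `u ∈ L⁶ ⇒ u(x) → 0`, which is proved here
(`IsDSolution.tendsto_zero_of_memLp_six`). Wang proves it (§2.1.3, p. 30) by the local Stokes
representation formula (2.4) and Hardy's inequality; the tree has no Stokes fundamental solution,
and this file runs instead Galdi's interior-estimate route with the tree's PROVED engines:

1. **Pressure normalisation.** The Calderón–Zygmund pressure `Q ∈ L³`, `−ΔQ = ∂ᵢ∂ⱼ(uᵢuⱼ)`
   (`nrs1996_rieszPressure_holds`) differs from `p` by a constant a.e.
   (`IsLerayProfile.exists_sub_ae_eq_const_of_lintegral_six`: Tsai's fixed-scale Liouville estimate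
   `IsLerayProfile.abs_fderiv_normed_convolution_sub_le`; NO boundedness of `u` is needed — the
   ball bounds come from Hölder for large balls and from continuity for small ones).
2. **First interior estimate** (`r = 3/2`, Cattabriga–Galdi, `stokes_interior_Lr_estimate_holds`)
   for the pair `(u, p − c)` on `B₂(x₀) ⊂ B₄(x₀)`, force `(u·∇)u`:
   `‖D²u‖_{L^{3/2}(B₂(x₀))} ≲ ‖u‖_{L⁶(B₄)}‖Du‖_{L²(B₄)} + ‖u‖_{L^{3/2}(B₄)} + ‖Du‖_{L^{3/2}(B₄)}
   + ‖Q‖_{L^{3/2}(B₄)} → 0` as `|x₀| → ∞` (tails of `∫|u|⁶`, `∫|Du|²`, `∫|Q|³`).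
3. **Gagliardo–Nirenberg–Sobolev** for the cut-off gradient `φDu` (Mathlib's
   `eLpNorm_le_eLpNorm_fderiv_of_eq`, `p = 3/2`, `p* = 3`): `‖Du‖_{L³(B₁(x₀))} → 0`.
4. **Second interior estimate** (`r = 2`) on `B_{1/2}(x₀) ⊂ B₁(x₀)`:
   `‖D²u‖_{L²(B_{1/2}(x₀))} ≲ ‖u‖_{L⁶(B₁)}‖Du‖_{L³(B₁)} + … → 0`.
5. **Sobolev imbedding `W^{2,2} ⊂ C_B` localised** (the tree's
   `FunctionSpaces.exists_enorm_le_sobolev_two_two_dim_three` applied to a cut-off of `u` around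
   `x₀`): `|u(x₀)| ≲ Σ_{j ≤ 2} ‖Dʲu‖_{L²(B_{1/2}(x₀))} → 0`.

Main results: `IsDSolution.tendsto_zero_of_memLp_six` (the order-zero velocity clause; = Galdi
X.5.1 with `u_∞ = 0`), `wang2025_thm21_DSolution_uniformDecay_holds` (**the discharge**).

## References

* W. Wang (王文栋), *稳态Navier–Stokes方程的Liouville定理*, Science Press (2025), Thm 2.1 (p. 28),
  proof §2.1.3 (pp. 30–31) (held `book:anonnd-navier-stokesliouville`, chunks p0028–p0031). [Wang2025]
* G. P. Galdi, *An Introduction to the Mathematical Theory of the Navier–Stokes Equations.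
  Steady-State Problems*, 2nd ed., Springer (2011), Thm X.5.1; Thm IV.4.1 (interior estimates);
  Thm X.1.1 (regularity). [Galdi2011]
* T.-P. Tsai, ARMA 143 (1998), (3.2) p. 37 (the interior estimate as used here) and Lemma 2.1
  (the Liouville step). [Tsai1998]
* J. Nečas, M. Růžička, V. Šverák, Acta Math. 176 (1996), Lemma 3.1. [NecasRuzickaSverak1996]
* R. A. Adams, *Sobolev Spaces* (1975), Thm 5.4. [Adams1975]
-/

noncomputable section

open MeasureTheory Set Filter Metric Topology InnerProductSpace Function ContinuousLinearMap
open scoped ENNReal NNReal RealInnerProductSpace ContDiff Laplacian Convolution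

namespace Literature.Analysis.FluidPDE

/-- Local notation for physical space `ℝ³ = EuclideanSpace ℝ (Fin 3)`. -/
local notation "ℝ³" => EuclideanSpace ℝ (Fin 3)

/-! ## §1. `L^p` bookkeeping on balls -/

section LpBalls

variable {G : Type*} [NormedAddCommGroup G]

/-- Hölder triples from real arithmetic: `p⁻¹ + q⁻¹ = r⁻¹` for positive reals gives
`ENNReal.HolderTriple p q r`. [folklore] -/
private theorem holderTriple_coe {p q r : ℝ≥0} (hp : p ≠ 0) (hq : q ≠ 0) (hr : r ≠ 0)
    (h : (p : ℝ)⁻¹ + (q : ℝ)⁻¹ = (r : ℝ)⁻¹) :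
    ENNReal.HolderTriple (p : ℝ≥0∞) (q : ℝ≥0∞) (r : ℝ≥0∞) := by
  constructor
  rw [← ENNReal.coe_inv hp, ← ENNReal.coe_inv hq, ← ENNReal.coe_inv hr, ← ENNReal.coe_add]
  congr 1
  rw [← NNReal.coe_inj]
  push_cast
  exact h

/-- **Tails on moving balls**: if `∫ ‖f‖^q < ∞` (`0 < q < ∞`) then `‖f‖_{L^q(B_R(x₀))} → 0` as
`|x₀| → ∞`. [folklore] -/
private theorem tendsto_eLpNorm_ball_cocompact {f : ℝ³ → G} {q : ℝ≥0∞} (hq0 : q ≠ 0) (hqtop : q ≠ ⊤)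
    (hf : ∫⁻ x, ‖f x‖ₑ ^ q.toReal ≠ ⊤) (R : ℝ) :
    Tendsto (fun x₀ : ℝ³ => eLpNorm f q (volume.restrict (ball x₀ R))) (cocompact ℝ³) (𝓝 0) := by
  have hq : 0 < q.toReal := ENNReal.toReal_pos hq0 hqtop
  have htail := CalderonSplittingLp.tendsto_setLIntegral_ball_cocompact' hf R
  have hcont : Tendsto (fun t : ℝ≥0∞ => t ^ (1 / q.toReal)) (𝓝 0) (𝓝 0) := by
    have h := (ENNReal.continuous_rpow_const (y := 1 / q.toReal)).tendsto 0
    rwa [ENNReal.zero_rpow_of_pos (by positivity)] at h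
  have h := hcont.comp htail
  refine h.congr fun x₀ => ?_
  rw [Function.comp_apply, eLpNorm_eq_lintegral_rpow_enorm_toReal hq0 hqtop]

/-- **Lowering the exponent on a ball**: `‖f‖_{L^p(B_R(x₀))} ≤ |B_R|^{1/p − 1/q} ‖f‖_{L^q(B_R(x₀))}`
for `p ≤ q`, with a constant independent of the centre. [folklore] -/
private theorem eLpNorm_ball_le_of_le {f : ℝ³ → G} (hf : AEStronglyMeasurable f volume) {p q : ℝ≥0∞}
    (hpq : p ≤ q) (x₀ : ℝ³) (R : ℝ) :
    eLpNorm f p (volume.restrict (ball x₀ R)) ≤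
      eLpNorm f q (volume.restrict (ball x₀ R)) * volume (ball (0 : ℝ³) R) ^ (1 / p.toReal - 1 / q.toReal) := by
  have h := eLpNorm_le_eLpNorm_mul_rpow_measure_univ hpq (hf.restrict (s := ball x₀ R))
  rwa [Measure.restrict_apply_univ, Measure.addHaar_ball_center] at h

/-- Lowering the exponent preserves decay on moving balls (`0 < p ≤ q < ∞`). [folklore] -/
private theorem tendsto_eLpNorm_ball_of_le {f : ℝ³ → G} (hf : AEStronglyMeasurable f volume)
    {p q : ℝ≥0∞} (hp0 : p ≠ 0) (hpq : p ≤ q) (hqtop : q ≠ ⊤) {R : ℝ}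
    (h : Tendsto (fun x₀ : ℝ³ => eLpNorm f q (volume.restrict (ball x₀ R))) (cocompact ℝ³) (𝓝 0)) :
    Tendsto (fun x₀ : ℝ³ => eLpNorm f p (volume.restrict (ball x₀ R))) (cocompact ℝ³) (𝓝 0) := by
  set K : ℝ≥0∞ := volume (ball (0 : ℝ³) R) ^ (1 / p.toReal - 1 / q.toReal) with hK
  have hexp : 0 ≤ 1 / p.toReal - 1 / q.toReal := by
    have hptop : p ≠ ⊤ := ne_top_of_le_ne_top hqtop hpq
    have hp : 0 < p.toReal := ENNReal.toReal_pos hp0 hptop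
    have hpq' : p.toReal ≤ q.toReal := (ENNReal.toReal_le_toReal hptop hqtop).2 hpq
    rw [sub_nonneg]
    exact one_div_le_one_div_of_le hp hpq'
  have hKtop : K ≠ ⊤ := (ENNReal.rpow_lt_top_of_nonneg hexp measure_ball_lt_top.ne).ne
  have hlim : Tendsto (fun x₀ : ℝ³ => eLpNorm f q (volume.restrict (ball x₀ R)) * K) (cocompact ℝ³)
      (𝓝 0) := by
    have := ENNReal.Tendsto.mul_const h (Or.inr hKtop)
    rwa [zero_mul] at this
  exact tendsto_of_tendsto_of_tendsto_of_le_of_le tendsto_const_nhds hlim (fun _ => zero_le)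
    fun x₀ => eLpNorm_ball_le_of_le hf hpq x₀ R

/-- **Hölder for the convective term on a set**: `‖(u·∇)u‖_{L^r(S)} ≤ ‖Du‖_{L^p(S)} ‖u‖_{L^q(S)}`
for `p⁻¹ + q⁻¹ = r⁻¹` (`|Du(x)[u(x)]| ≤ ‖Du(x)‖ |u(x)|`). [folklore] -/
private theorem eLpNorm_convect_le {u : ℝ³ → ℝ³} (hu : ContDiff ℝ 1 u) (μ : Measure ℝ³)
    (p q r : ℝ≥0∞) [ENNReal.HolderTriple p q r] :
    eLpNorm (convect u u) r μ ≤ eLpNorm (fderiv ℝ u) p μ * eLpNorm u q μ := by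
  have hf : AEStronglyMeasurable (fderiv ℝ u) μ := (hu.continuous_fderiv one_ne_zero).aestronglyMeasurable
  have hg : AEStronglyMeasurable u μ := hu.continuous.aestronglyMeasurable
  have h := eLpNorm_le_eLpNorm_mul_eLpNorm_of_nnnorm (p := p) (q := q) (r := r) hf hg
    (fun L v => L v) 1
    (Eventually.of_forall fun x => by simpa using (fderiv ℝ u x).le_opNNNorm (u x)) (μ := μ)
  have e : convect u u = fun x => (fderiv ℝ u x) (u x) := rfl
  rw [e]
  simpa using h

end LpBalls

/-! ## §2. The Liouville step for the pressure without boundedness: `U ∈ L⁶`, `Q ∈ L³` -/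

section PressureConstancy

open TopologicalSpace

variable {ν a : ℝ} {U : ℝ³ → ℝ³} {P : ℝ³ → ℝ}

/-- Two-regime ball bounds: a Hölder bound `∫_{B̄_ϱ}‖F‖ ≤ A ϱ^s` (used for `ϱ ≥ 1`, `s ≤ t`)
and an a.e. bound `‖F‖ ≤ B` on `B(0, 2)` (used for `ϱ ≤ 1`, `t ≤ 3`) give
`∫_{B̄_ϱ}‖F‖ ≤ (A + B |B₁|) ϱ^t` for all `ϱ > 0`. [folklore] -/
private theorem ballBound_of_two_regimes {G : Type*} [NormedAddCommGroup G] {F : ℝ³ → G}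
    {A s t B : ℝ} (hA : 0 ≤ A) (hB : 0 ≤ B) (hst : s ≤ t) (ht3 : t ≤ 3)
    (hlarge : ∀ ϱ : ℝ, 0 < ϱ → IntegrableOn F (closedBall (0 : ℝ³) ϱ) ∧
      ∫ x in closedBall (0 : ℝ³) ϱ, ‖F x‖ ≤ A * ϱ ^ s)
    (hsmall : ∀ᵐ x ∂(volume.restrict (ball (0 : ℝ³) 2)), ‖F x‖ ≤ B) :
    ∀ ϱ : ℝ, 0 < ϱ → IntegrableOn F (closedBall (0 : ℝ³) ϱ) ∧
      ∫ x in closedBall (0 : ℝ³) ϱ, ‖F x‖ ≤ (A + B * (volume : Measure ℝ³).real (ball (0 : ℝ³) 1)) * ϱ ^ t := by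
  set v : ℝ := (volume : Measure ℝ³).real (ball (0 : ℝ³) 1) with hv_def
  have hv0 : 0 ≤ v := measureReal_nonneg
  intro ϱ hϱ
  obtain ⟨hint, hϱA⟩ := hlarge ϱ hϱ
  refine ⟨hint, ?_⟩
  rcases le_total ϱ 1 with hϱ1 | hϱ1
  · have hsub : closedBall (0 : ℝ³) ϱ ⊆ ball (0 : ℝ³) 2 := closedBall_subset_ball (by linarith)
    have hae' : ∀ᵐ x ∂(volume.restrict (closedBall (0 : ℝ³) ϱ)), ‖F x‖ ≤ B :=
      ae_restrict_of_ae_restrict_of_subset hsub hsmall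
    have hvolϱ : (volume : Measure ℝ³).real (closedBall (0 : ℝ³) ϱ) = ϱ ^ 3 * v := by
      rw [Measure.addHaar_real_closedBall _ _ hϱ.le, finrank_euclideanSpace_fin]
    have hconst : IntegrableOn (fun _ => B) (closedBall (0 : ℝ³) ϱ) volume :=
      integrableOn_const measure_closedBall_lt_top.ne
    have h1 : ∫ x in closedBall (0 : ℝ³) ϱ, ‖F x‖ ≤ ∫ _ in closedBall (0 : ℝ³) ϱ, B :=
      integral_mono_ae hint.norm hconst hae'
    rw [setIntegral_const, smul_eq_mul, hvolϱ] at h1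
    have hpow : ϱ ^ 3 ≤ ϱ ^ t := by
      rw [show ϱ ^ 3 = ϱ ^ (3 : ℝ) by rw [← Real.rpow_natCast]; norm_num]
      exact Real.rpow_le_rpow_of_exponent_ge hϱ hϱ1 ht3
    calc ∫ x in closedBall (0 : ℝ³) ϱ, ‖F x‖ ≤ ϱ ^ 3 * v * B := h1
      _ ≤ ϱ ^ t * v * B := by gcongr
      _ = (B * v) * ϱ ^ t := by ring
      _ ≤ (A + B * v) * ϱ ^ t :=
          mul_le_mul_of_nonneg_right (le_add_of_nonneg_left hA) (by positivity)
  · have hpow : ϱ ^ s ≤ ϱ ^ t := Real.rpow_le_rpow_of_exponent_le hϱ1 hst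
    calc ∫ x in closedBall (0 : ℝ³) ϱ, ‖F x‖ ≤ A * ϱ ^ s := hϱA
      _ ≤ A * ϱ ^ t := mul_le_mul_of_nonneg_left hpow hA
      _ ≤ (A + B * v) * ϱ ^ t :=
          mul_le_mul_of_nonneg_right (le_add_of_nonneg_right (by positivity)) (by positivity)

/-- **The Liouville step for `U ∈ L⁶` (no boundedness): mollifications of `P − Q` have zero
gradient** (Galdi 2011, proof of Thm X.5.1: the pressure of a `D`-solution with `u ∈ L⁶` is, up to
a constant, the Calderón–Zygmund pressure `RᵢRⱼ(UᵢUⱼ) ∈ L³`; argument of NRŠ 1996, Lemma 3.1 /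
Tsai 1998, Lemma 2.1). Let `(U, P)` be a Leray profile (`U ∈ C²`) with `∫ |U|⁶ < ∞` and `Q ∈ L³` a
weak solution of `−ΔQ = ∂ᵢ∂ⱼ(UᵢUⱼ)`. Then every `ψ ⋆ (P − Q)` has zero gradient: Tsai's fixed-scale
estimate `IsLerayProfile.abs_fderiv_normed_convolution_sub_le` with the ball bounds
`∫_{B_ϱ}|U| ≲ ϱ^{13/5}`, `∫_{B_ϱ}|U|² ≲ ϱ^{11/5}`, `∫_{B_ϱ}|Q| ≲ ϱ^{11/5}` — Hölder (`U ∈ L⁶`: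
`ϱ^{5/2}`, `ϱ²`; `Q ∈ L³`: `ϱ²`) for `ϱ ≥ 1`, and for `ϱ ≤ 1` continuity of `U` and the interior
estimate for the weakly harmonic `P − Q`. [cite: Galdi2011, Thm X.5.1 (proof); NecasRuzickaSverak1996, Lemma 3.1 proof (pp. 287–288)] -/
theorem IsLerayProfile.fderiv_normed_convolution_sub_eq_zero_of_lintegral_six
    (hprof : IsLerayProfile ν a U P) (hIU : ∫⁻ y, ‖U y‖ₑ ^ (6 : ℝ) ≠ ⊤)
    {Q : ℝ³ → ℝ} (hQm : AEStronglyMeasurable Q volume) (hIQ : ∫⁻ y, ‖Q y‖ₑ ^ (3 : ℝ) ≠ ⊤)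
    (hQ : ∀ φ : ℝ³ → ℝ, ContDiff ℝ (⊤ : ℕ∞) φ → HasCompactSupport φ →
      ∫ y, Q y * (Δ φ) y = -∫ y, fderiv ℝ (fderiv ℝ φ) y (U y) (U y))
    (ψ : ContDiffBump (0 : ℝ³)) (y e : ℝ³) :
    fderiv ℝ (ψ.normed volume ⋆[lsmul ℝ ℝ, volume] fun x => P x - Q x) y e = 0 := by
  -- exponents and basic regularity
  have hpq₆ : (6 : ℝ).HolderConjugate (6 / 5) := ⟨by norm_num, by norm_num, by norm_num⟩
  have hpq₃ : (3 : ℝ).HolderConjugate (3 / 2) := ⟨by norm_num, by norm_num, by norm_num⟩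
  have hU1 : ContDiff ℝ 1 U := hprof.contDiff_velocity.of_le one_le_two
  have hP1 := hprof.contDiff_pressure
  have hUc : Continuous U := hU1.continuous
  have hUm : AEStronglyMeasurable U volume := hUc.aestronglyMeasurable
  have hU2m : AEStronglyMeasurable (fun x => ‖U x‖ ^ 2) volume := (hUc.norm.pow 2).aestronglyMeasurable
  have hIU2 : ∫⁻ x, ‖(‖U x‖ ^ 2)‖ₑ ^ (3 : ℝ) ≠ ⊤ := by
    have h : ∀ x, ‖(‖U x‖ ^ 2)‖ₑ ^ (3 : ℝ) = ‖U x‖ₑ ^ (6 : ℝ) := fun x => by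
      rw [Real.enorm_eq_ofReal (sq_nonneg _), ENNReal.ofReal_pow (norm_nonneg _), ofReal_norm,
        ← ENNReal.rpow_natCast, ← ENNReal.rpow_mul]
      norm_num
    simp_rw [h]
    exact hIU
  set v : ℝ := (volume : Measure ℝ³).real (ball (0 : ℝ³) 1) with hv_def
  have hv0 : 0 ≤ v := measureReal_nonneg
  -- continuity bound of `U` on `B̄(0, 2)`
  obtain ⟨MU, hMU⟩ := (isCompact_closedBall (0 : ℝ³) 2).exists_bound_of_continuousOn hUc.continuousOn
  set MU' : ℝ := max MU 0 with hMU'_def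
  have hMU'0 : 0 ≤ MU' := le_max_right _ _
  have hUsmall : ∀ᵐ x ∂(volume.restrict (ball (0 : ℝ³) 2)), ‖U x‖ ≤ MU' := by
    filter_upwards [ae_restrict_mem measurableSet_ball] with x hx
    exact (hMU x (ball_subset_closedBall hx)).trans (le_max_left _ _)
  have hU2small : ∀ᵐ x ∂(volume.restrict (ball (0 : ℝ³) 2)), ‖(‖U x‖ ^ 2)‖ ≤ MU' ^ 2 := by
    filter_upwards [hUsmall] with x hx
    rw [Real.norm_of_nonneg (sq_nonneg _)]
    exact pow_le_pow_left₀ (norm_nonneg _) hx 2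
  -- the ball bounds for `U` and `|U|²`
  set AU₁ : ℝ := ((∫⁻ x, ‖U x‖ₑ ^ (6 : ℝ)) ^ (1 / (6 : ℝ)) *
    volume (ball (0 : ℝ³) 1) ^ (1 / (6 / 5 : ℝ))).toReal with hAU₁_def
  have hAU₁0 : 0 ≤ AU₁ := ENNReal.toReal_nonneg
  have hballU₁ : ∀ ϱ : ℝ, 0 < ϱ → IntegrableOn U (closedBall (0 : ℝ³) ϱ) ∧
      ∫ x in closedBall (0 : ℝ³) ϱ, ‖U x‖ ≤ AU₁ * ϱ ^ (5 / 2 : ℝ) := fun ϱ hϱ => by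
    have h := setIntegral_norm_closedBall_le_holder hUm hpq₆ hIU hϱ
    exact ⟨h.1, h.2.trans_eq (by rw [hAU₁_def]; norm_num)⟩
  have hballU := ballBound_of_two_regimes hAU₁0 hMU'0 (by norm_num : (5 / 2 : ℝ) ≤ 13 / 5)
    (by norm_num) hballU₁ hUsmall
  set AU2₁ : ℝ := ((∫⁻ x, ‖(‖U x‖ ^ 2)‖ₑ ^ (3 : ℝ)) ^ (1 / (3 : ℝ)) *
    volume (ball (0 : ℝ³) 1) ^ (1 / (3 / 2 : ℝ))).toReal with hAU2₁_def
  have hAU2₁0 : 0 ≤ AU2₁ := ENNReal.toReal_nonneg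
  have hballU2₁ : ∀ ϱ : ℝ, 0 < ϱ → IntegrableOn (fun x => ‖U x‖ ^ 2) (closedBall (0 : ℝ³) ϱ) ∧
      ∫ x in closedBall (0 : ℝ³) ϱ, ‖(‖U x‖ ^ 2)‖ ≤ AU2₁ * ϱ ^ (2 : ℝ) := fun ϱ hϱ => by
    have h := setIntegral_norm_closedBall_le_holder hU2m hpq₃ hIU2 hϱ
    exact ⟨h.1, h.2.trans_eq (by rw [hAU2₁_def]; norm_num)⟩
  have hballU2 := ballBound_of_two_regimes hAU2₁0 (sq_nonneg MU') (by norm_num : (2 : ℝ) ≤ 11 / 5)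
    (by norm_num) hballU2₁ hU2small
  -- `P - Q` is weakly harmonic
  have hQl : LocallyIntegrable Q volume := locallyIntegrable_of_holder hQm hpq₃ hIQ
  have hgl : LocallyIntegrable (fun x => P x - Q x) volume :=
    hP1.continuous.locallyIntegrable.sub hQl
  have hharm : ∀ φ : ℝ³ → ℝ, ContDiff ℝ (⊤ : ℕ∞) φ → HasCompactSupport φ →
      ∫ x, (P x - Q x) * (Δ φ) x = 0 := by
    intro φ hφ hφc
    have hΔc : Continuous (Δ φ) := FluidPDE.continuous_laplacian (contDiff_infty.1 hφ 2)
    have hΔs : HasCompactSupport (Δ φ) :=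
      hφc.mono' fun x hx => by
        contrapose! hx
        simp [FluidPDE.laplacian_eq_zero_of_notMem_tsupport hx]
    have i1 : Integrable fun x => P x * (Δ φ) x :=
      (hP1.continuous.mul hΔc).integrable_of_hasCompactSupport hΔs.mul_left
    have i2 : Integrable fun x => Q x * (Δ φ) x := by
      simpa only [smul_eq_mul] using hQl.integrable_smul_right_of_hasCompactSupport hΔc hΔs
    simp_rw [sub_mul]
    rw [integral_sub i1 i2, hprof.integral_pressure_mul_laplacian_eq_neg_integral_hessian hφ hφc,
      hQ φ hφ hφc, sub_self]
  -- the ball bound for `Q`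
  set AQ₁ : ℝ := ((∫⁻ x, ‖Q x‖ₑ ^ (3 : ℝ)) ^ (1 / (3 : ℝ)) *
    volume (ball (0 : ℝ³) 1) ^ (1 / (3 / 2 : ℝ))).toReal with hAQ₁_def
  have hAQ₁0 : 0 ≤ AQ₁ := ENNReal.toReal_nonneg
  have hballQ₁ : ∀ ϱ : ℝ, 0 < ϱ → IntegrableOn Q (closedBall (0 : ℝ³) ϱ) ∧
      ∫ x in closedBall (0 : ℝ³) ϱ, ‖Q x‖ ≤ AQ₁ * ϱ ^ (2 : ℝ) := fun ϱ hϱ => by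
    have h := setIntegral_norm_closedBall_le_holder hQm hpq₃ hIQ hϱ
    exact ⟨h.1, h.2.trans_eq (by rw [hAQ₁_def]; norm_num)⟩
  obtain ⟨Cw, hCw0, hCw⟩ := exists_const_ae_abs_le_integral_of_weaklyHarmonic
  have hint4 : IntegrableOn (fun x => P x - Q x) (ball (0 : ℝ³) 4) volume :=
    (hgl.integrableOn_isCompact (isCompact_closedBall 0 4)).mono_set ball_subset_closedBall
  set K : ℝ := Cw * ((4 : ℝ) ^ 3)⁻¹ * ∫ x in ball (0 : ℝ³) 4, |P x - Q x| with hK_def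
  have hK0 : 0 ≤ K := by
    rw [hK_def]
    exact mul_nonneg (by positivity) (integral_nonneg fun x => abs_nonneg _)
  have hae : ∀ᵐ x ∂(volume.restrict (ball (0 : ℝ³) 2)), |P x - Q x| ≤ K := by
    have h := hCw (fun x => P x - Q x) 0 4 (by norm_num) hint4 (fun φ hφ hφc _ => hharm φ hφ hφc)
    rw [show (4 : ℝ) / 2 = 2 by norm_num] at h
    exact h
  obtain ⟨MP, hMP⟩ := (isCompact_closedBall (0 : ℝ³) 2).exists_bound_of_continuousOn
    hP1.continuous.continuousOn
  set MP' : ℝ := max MP 0 with hMP'_def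
  have hMP'0 : 0 ≤ MP' := le_max_right _ _
  have hQsmall : ∀ᵐ x ∂(volume.restrict (ball (0 : ℝ³) 2)), ‖Q x‖ ≤ MP' + K := by
    filter_upwards [hae, ae_restrict_mem measurableSet_ball] with x hx hxmem
    have hPx : |P x| ≤ MP' :=
      (Real.norm_eq_abs _ ▸ hMP x (ball_subset_closedBall hxmem)).trans (le_max_left _ _)
    rw [Real.norm_eq_abs]
    calc |Q x| = |P x - (P x - Q x)| := by ring_nf
      _ ≤ |P x| + |P x - Q x| := abs_sub _ _
      _ ≤ MP' + K := add_le_add hPx hx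
  have hballQ := ballBound_of_two_regimes hAQ₁0 (add_nonneg hMP'0 hK0)
    (by norm_num : (2 : ℝ) ≤ 11 / 5) (by norm_num) hballQ₁ hQsmall
  -- constants and the fixed-scale estimate
  obtain ⟨⟨C₁, hC₁⟩, ⟨C₂, hC₂⟩⟩ := exists_bound_baseBump_derivs (E := ℝ³)
  have hC₁0 : 0 ≤ C₁ := (norm_nonneg _).trans (hC₁ 0)
  have hC₂0 : 0 ≤ C₂ := (abs_nonneg _).trans (hC₂ 0)
  obtain ⟨K', hK'⟩ : ∃ K' : ℝ, ∀ R : ℝ, 1 ≤ R →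
      |fderiv ℝ (ψ.normed volume ⋆[lsmul ℝ ℝ, volume] fun x => P x - Q x) y e| ≤
        K' * R ^ (-(2 / 5) : ℝ) :=
    ⟨_, fun R hR => hprof.abs_fderiv_normed_convolution_sub_le hQl hharm (by positivity)
      (by positivity) (by positivity) hballU hballU2 hballQ hC₁ hC₂ hC₁0 hC₂0 ψ y e hR⟩
  have hlim : Tendsto (fun R : ℝ => K' * R ^ (-(2 / 5) : ℝ)) atTop (𝓝 0) := by
    simpa using (tendsto_rpow_neg_atTop (by norm_num : (0 : ℝ) < 2 / 5)).const_mul K'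
  have hle : |fderiv ℝ (ψ.normed volume ⋆[lsmul ℝ ℝ, volume] fun x => P x - Q x) y e| ≤ 0 :=
    ge_of_tendsto hlim (eventually_atTop.2 ⟨1, fun R hR => hK' R hR⟩)
  exact abs_nonpos_iff.1 hle

/-- **`P − Q` is a.e. constant** for a Leray profile with `∫ |U|⁶ < ∞` (no boundedness assumed)
and `Q ∈ L³` solving the pressure Poisson equation weakly (Galdi 2011, proof of Thm X.5.1; NRŠ
1996, Lemma 3.1): every mollification of `P − Q` has zero gradient, hence is constant, and the
mollifications converge to `P − Q` a.e. [cite: Galdi2011, Thm X.5.1 (proof); NecasRuzickaSverak1996, Lemma 3.1 (p. 287)] -/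
theorem IsLerayProfile.exists_sub_ae_eq_const_of_lintegral_six (hprof : IsLerayProfile ν a U P)
    (hIU : ∫⁻ y, ‖U y‖ₑ ^ (6 : ℝ) ≠ ⊤)
    {Q : ℝ³ → ℝ} (hQm : AEStronglyMeasurable Q volume) (hIQ : ∫⁻ y, ‖Q y‖ₑ ^ (3 : ℝ) ≠ ⊤)
    (hQ : ∀ φ : ℝ³ → ℝ, ContDiff ℝ (⊤ : ℕ∞) φ → HasCompactSupport φ →
      ∫ y, Q y * (Δ φ) y = -∫ y, fderiv ℝ (fderiv ℝ φ) y (U y) (U y)) :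
    ∃ c : ℝ, ∀ᵐ x ∂(volume : Measure ℝ³), P x - Q x = c := by
  have hpq₃ : (3 : ℝ).HolderConjugate (3 / 2) := ⟨by norm_num, by norm_num, by norm_num⟩
  have hQl : LocallyIntegrable Q volume := locallyIntegrable_of_holder hQm hpq₃ hIQ
  set g : ℝ³ → ℝ := fun x => P x - Q x with hg_def
  have hgl : LocallyIntegrable g volume :=
    hprof.contDiff_pressure.continuous.locallyIntegrable.sub hQl
  obtain ⟨φ, hφ0, hφ2⟩ := FunctionSpaces.exists_contDiffBump_seq (E := ℝ³)
  have hconst : ∀ k x, ((φ k).normed volume ⋆[lsmul ℝ ℝ, volume] g) x =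
      ((φ k).normed volume ⋆[lsmul ℝ ℝ, volume] g) 0 := by
    intro k x
    have hdiff : Differentiable ℝ ((φ k).normed volume ⋆[lsmul ℝ ℝ, volume] g) :=
      ((φ k).hasCompactSupport_normed.contDiff_convolution_left _
        ((φ k).contDiff_normed (n := 1)) hgl).differentiable one_ne_zero
    have hzero : ∀ y, fderiv ℝ ((φ k).normed volume ⋆[lsmul ℝ ℝ, volume] g) y = 0 := fun y => by
      ext e
      exact hprof.fderiv_normed_convolution_sub_eq_zero_of_lintegral_six hIU hQm hIQ hQ (φ k) y e
    exact is_const_of_fderiv_eq_zero hdiff hzero x 0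
  have hlim := FunctionSpaces.ae_tendsto_normed_convolution hφ0 hφ2 hgl
  refine ⟨limUnder atTop fun k => ((φ k).normed volume ⋆[lsmul ℝ ℝ, volume] g) 0, ?_⟩
  filter_upwards [hlim] with x hx
  simp_rw [hconst _ x] at hx
  exact hx.limUnder_eq.symm

end PressureConstancy

/-! ## §3. The order-zero velocity clause: `u ∈ L⁶ ⇒ u(x) → 0` -/

section VelocityDecay

/-- Uniform bounds for the derivatives up to order `2` of the translates of a fixed bump
(`ψ_{x₀}(y) = ψ₀(y − x₀)`, radii `r < R`). [folklore] -/
private theorem exists_bump_bounds (r R : ℝ) (hr : 0 < r) (hrR : r < R) :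
    ∃ A : ℝ, 0 ≤ A ∧ ∀ (x₀ : ℝ³), ∀ i ∈ Finset.range 3, ∀ y,
      ‖iteratedFDeriv ℝ i ((⟨r, R, hr, hrR⟩ : ContDiffBump x₀) : ℝ³ → ℝ) y‖ ≤ A := by
  set ψ₀ : ContDiffBump (0 : ℝ³) := ⟨r, R, hr, hrR⟩ with hψ₀
  have hbd : ∀ i : ℕ, ∃ A : ℝ, ∀ y, ‖iteratedFDeriv ℝ i ψ₀ y‖ ≤ A := fun i =>
    (ψ₀.contDiff.continuous_iteratedFDeriv (m := i)
      (by exact_mod_cast le_top)).bounded_above_of_compact_support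
        (ψ₀.hasCompactSupport.iteratedFDeriv i)
  choose A hA using hbd
  set A' : ℝ := max (max (A 0) (A 1)) (max (A 2) 0) with hA'
  refine ⟨A', le_max_of_le_right (le_max_right _ _), fun x₀ i hi y => ?_⟩
  set ψ : ContDiffBump x₀ := ⟨r, R, hr, hrR⟩ with hψ
  have htr : ((ψ : ℝ³ → ℝ)) = fun x => ψ₀ (x + -x₀) := by
    funext x
    rw [ContDiffBump.apply, ContDiffBump.apply, sub_zero, sub_eq_add_neg]
  rw [htr, iteratedFDeriv_comp_add_right]
  have hi' : i = 0 ∨ i = 1 ∨ i = 2 := by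
    have := Finset.mem_range.1 hi; omega
  rcases hi' with rfl | rfl | rfl
  · exact (hA 0 _).trans (le_max_of_le_left (le_max_left _ _))
  · exact (hA 1 _).trans (le_max_of_le_left (le_max_right _ _))
  · exact (hA 2 _).trans (le_max_of_le_right (le_max_left _ _))

/-- Leibniz for a cut-off: `‖Dʲ(ψu)(y)‖ ≤ 2A (‖D²u(y)‖ + ‖Du(y)‖ + ‖u(y)‖)` for `j ≤ 2` when
`‖Dⁱψ‖ ≤ A` for `i ≤ 2`. [folklore] -/
private theorem norm_iteratedFDeriv_cutoff_smul_le_three {ψ : ℝ³ → ℝ} {u : ℝ³ → ℝ³} (hψ : ContDiff ℝ 2 ψ)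
    (hu : ContDiff ℝ 2 u) {A : ℝ} (hA : ∀ i ∈ Finset.range 3, ∀ y, ‖iteratedFDeriv ℝ i ψ y‖ ≤ A)
    {j : ℕ} (hj : j ∈ Finset.range 3) (y : ℝ³) :
    ‖iteratedFDeriv ℝ j (fun y => ψ y • u y) y‖ ≤
      2 * A * (‖iteratedFDeriv ℝ 2 u y‖ + ‖fderiv ℝ u y‖ + ‖u y‖) := by
  have hA0 : 0 ≤ A := (norm_nonneg _).trans (hA 0 (by simp) y)
  have hjle : j ≤ 2 := by have := Finset.mem_range.1 hj; omega
  have hj2 : (j : ℕ∞ω) ≤ 2 := by exact_mod_cast hjle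
  have hLeib := norm_iteratedFDeriv_smul_le hψ hu y hj2
  refine hLeib.trans ?_
  have hterm : ∀ i ∈ Finset.range (j + 1), (j.choose i : ℝ) * ‖iteratedFDeriv ℝ i ψ y‖ *
      ‖iteratedFDeriv ℝ (j - i) u y‖ ≤ 2 * A * ‖iteratedFDeriv ℝ (j - i) u y‖ := by
    intro i hi
    have hij : i ≤ j := Nat.lt_succ_iff.1 (Finset.mem_range.1 hi)
    have hchoose : (j.choose i : ℝ) ≤ 2 := by
      have : j.choose i ≤ 2 := by
        interval_cases j <;> interval_cases i <;> decide
      exact_mod_cast this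
    have hi3 : i ∈ Finset.range 3 := Finset.mem_range.2 (by omega)
    exact mul_le_mul_of_nonneg_right
      (mul_le_mul hchoose (hA i hi3 y) (norm_nonneg _) zero_le_two) (norm_nonneg _)
  refine (Finset.sum_le_sum hterm).trans ?_
  rw [← Finset.mul_sum]
  refine mul_le_mul_of_nonneg_left ?_ (by positivity)
  have e0 : ‖iteratedFDeriv ℝ 0 u y‖ = ‖u y‖ := norm_iteratedFDeriv_zero
  have e1 : ‖iteratedFDeriv ℝ 1 u y‖ = ‖fderiv ℝ u y‖ := by
    rw [← norm_iteratedFDeriv_fderiv, norm_iteratedFDeriv_zero]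
  have h0 : 0 ≤ ‖u y‖ := norm_nonneg _
  have h1 : 0 ≤ ‖fderiv ℝ u y‖ := norm_nonneg _
  have h2 : 0 ≤ ‖iteratedFDeriv ℝ 2 u y‖ := norm_nonneg _
  have hj' : j = 0 ∨ j = 1 ∨ j = 2 := by omega
  rcases hj' with rfl | rfl | rfl
  · simp only [Finset.sum_range_succ, Finset.sum_range_zero, zero_add, Nat.sub_zero, e0]
    linarith
  · simp only [Finset.sum_range_succ, Finset.sum_range_zero, zero_add, Nat.sub_zero, e0, e1]
    linarith
  · simp only [Finset.sum_range_succ, Finset.sum_range_zero, zero_add, Nat.sub_zero, e0, e1]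
    linarith

/-- Away from the support of the cut-off all derivatives of `ψu` vanish. [folklore] -/
private theorem iteratedFDeriv_smul_eq_zero_of_notMem {ψ : ℝ³ → ℝ} {u : ℝ³ → ℝ³} {y : ℝ³}
    (hy : y ∉ tsupport ψ) (j : ℕ) : iteratedFDeriv ℝ j (fun y => ψ y • u y) y = 0 := by
  have hg0 : (fun y => ψ y • u y) =ᶠ[𝓝 y] 0 := by
    filter_upwards [notMem_tsupport_iff_eventuallyEq.1 hy] with z hz
    simp only [Pi.zero_apply] at hz ⊢
    rw [hz, zero_smul]
  exact Function.notMem_support.1 fun h =>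
    (notMem_tsupport_iff_eventuallyEq.2 hg0) (support_iteratedFDeriv_subset j h)

/-- **Gagliardo–Nirenberg–Sobolev for the cut-off gradient** (step 3 of the module docstring):
there is a finite `K` such that for every `C²` field `u` on `ℝ³` and every centre `x₀`,
`‖Du‖_{L³(B₁(x₀))} ≤ K (‖D²u‖_{L^{3/2}(B₂(x₀))} + ‖Du‖_{L^{3/2}(B₂(x₀))} + ‖u‖_{L^{3/2}(B₂(x₀))})`:
apply Mathlib's inequality `‖w‖_{L³} ≤ C ‖Dw‖_{L^{3/2}}` (`eLpNorm_le_eLpNorm_fderiv_of_eq`, `n = 3`)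
to `w = D(ψu)` for translates `ψ = ψ_{x₀}` of one bump (`= 1` on `B₁(x₀)`, supported in
`B̄_{3/2}(x₀)`), so that `w = Du` on `B₁(x₀)` and `‖Dw‖ = ‖D²(ψu)‖ ≤ 2A(‖D²u‖ + ‖Du‖ + ‖u‖)`
(Leibniz). [cite: Adams1975, Lemma 5.10 (Gagliardo–Nirenberg–Sobolev)] -/
theorem exists_eLpNorm_fderiv_three_ball_le :
    ∃ K : ℝ≥0∞, K ≠ ⊤ ∧ ∀ (u : ℝ³ → ℝ³), ContDiff ℝ 2 u → ∀ x₀ : ℝ³,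
      eLpNorm (fderiv ℝ u) 3 (volume.restrict (ball x₀ 1)) ≤
        K * (eLpNorm (fun x => iteratedFDeriv ℝ 2 u x) ((3 / 2 : ℝ≥0) : ℝ≥0∞)
            (volume.restrict (ball x₀ 2)) +
          eLpNorm (fun x => fderiv ℝ u x) ((3 / 2 : ℝ≥0) : ℝ≥0∞) (volume.restrict (ball x₀ 2)) +
          eLpNorm u ((3 / 2 : ℝ≥0) : ℝ≥0∞) (volume.restrict (ball x₀ 2))) := by
  obtain ⟨A, hA0, hA⟩ := exists_bump_bounds 1 (3 / 2) one_pos (by norm_num)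
  set KG : ℝ≥0∞ := (SNormLESNormFDerivOfEqConst (ℝ³ →L[ℝ] ℝ³) (volume : Measure ℝ³) (3 / 2 : ℝ≥0) :
    ℝ≥0∞) with hKG
  set cA : ℝ≥0 := Real.toNNReal (2 * A) with hcA
  have hcoe : ((cA : ℝ≥0) : ℝ) = 2 * A := by rw [hcA, Real.coe_toNNReal _ (by positivity)]
  have h1r : (1 : ℝ≥0∞) ≤ ((3 / 2 : ℝ≥0) : ℝ≥0∞) := by
    rw [← ENNReal.coe_one, ENNReal.coe_le_coe, ← NNReal.coe_le_coe]; push_cast; norm_num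
  refine ⟨KG * cA, ENNReal.mul_ne_top ENNReal.coe_ne_top ENNReal.coe_ne_top, fun u hu2 x₀ => ?_⟩
  have hum : AEStronglyMeasurable u volume := hu2.continuous.aestronglyMeasurable
  have hDum : AEStronglyMeasurable (fun x => fderiv ℝ u x) volume :=
    (hu2.continuous_fderiv (by norm_num)).aestronglyMeasurable
  have hD2m : AEStronglyMeasurable (fun x => iteratedFDeriv ℝ 2 u x) volume :=
    (hu2.continuous_iteratedFDeriv le_rfl).aestronglyMeasurable
  set ψ : ContDiffBump x₀ := ⟨1, 3 / 2, one_pos, by norm_num⟩ with hψ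
  -- the localised velocity `g = ψu` and `w = Dg`
  have hgc : ContDiff ℝ 2 (fun y => ψ y • u y) := (ψ.contDiff (n := 2)).smul hu2
  have hgs : HasCompactSupport (fun y => ψ y • u y) := ψ.hasCompactSupport.smul_right
  have hw1 : ContDiff ℝ 1 (fderiv ℝ (fun y => ψ y • u y)) := hgc.fderiv_right (m := 1) le_rfl
  have hwc : HasCompactSupport (fderiv ℝ (fun y => ψ y • u y)) := hgs.fderiv ℝ
  -- GNS, `p = 3/2`, `p* = 3`
  have hGNS := eLpNorm_le_eLpNorm_fderiv_of_eq (volume : Measure ℝ³) hw1 hwc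
    (p := (3 / 2 : ℝ≥0)) (p' := 3) (by rw [← NNReal.coe_le_coe]; push_cast; norm_num)
    (by rw [finrank_euclideanSpace_fin]; norm_num)
    (by rw [finrank_euclideanSpace_fin]; push_cast; norm_num)
  simp only [ENNReal.coe_ofNat] at hGNS
  -- (i) `‖Du‖_{L³(B₁)} ≤ ‖D(ψu)‖_{L³}`: `ψ = 1` on `B₁(x₀)`
  have hi : eLpNorm (fderiv ℝ u) 3 (volume.restrict (ball x₀ 1)) ≤
      eLpNorm (fderiv ℝ (fun y => ψ y • u y)) 3 volume := by
    have heq : eLpNorm (fderiv ℝ u) 3 (volume.restrict (ball x₀ 1)) =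
        eLpNorm (fderiv ℝ (fun y => ψ y • u y)) 3 (volume.restrict (ball x₀ 1)) := by
      refine eLpNorm_congr_ae ?_
      filter_upwards [ae_restrict_mem measurableSet_ball] with y hy
      have hloc : (fun y => ψ y • u y) =ᶠ[𝓝 y] u := by
        filter_upwards [isOpen_ball.mem_nhds hy] with z hz
        have h1 : ψ z = 1 := ψ.one_of_mem_closedBall (ball_subset_closedBall hz)
        rw [h1, one_smul]
      exact (hloc.fderiv_eq).symm
    rw [heq]
    exact eLpNorm_mono_measure _ Measure.restrict_le_self
  -- (ii) `‖D²(ψu)‖_{L^{3/2}} ≤ 2A (‖D²u‖ + ‖Du‖ + ‖u‖)_{L^{3/2}(B₂(x₀))}`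
  have hD2 : eLpNorm (fderiv ℝ (fderiv ℝ (fun y => ψ y • u y))) ((3 / 2 : ℝ≥0) : ℝ≥0∞) volume =
      eLpNorm (fun y => ‖iteratedFDeriv ℝ 2 (fun y => ψ y • u y) y‖) ((3 / 2 : ℝ≥0) : ℝ≥0∞) volume := by
    rw [← eLpNorm_norm (fderiv ℝ (fderiv ℝ (fun y => ψ y • u y)))]
    simp_rw [FunctionSpaces.norm_fderiv_fderiv_eq_norm_iteratedFDeriv_two]
  have hii : eLpNorm (fun y => ‖iteratedFDeriv ℝ 2 (fun y => ψ y • u y) y‖) ((3 / 2 : ℝ≥0) : ℝ≥0∞)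
        volume ≤
      (cA : ℝ≥0∞) *
        (eLpNorm (fun x => iteratedFDeriv ℝ 2 u x) ((3 / 2 : ℝ≥0) : ℝ≥0∞) (volume.restrict (ball x₀ 2)) +
          eLpNorm (fun x => fderiv ℝ u x) ((3 / 2 : ℝ≥0) : ℝ≥0∞) (volume.restrict (ball x₀ 2)) +
          eLpNorm u ((3 / 2 : ℝ≥0) : ℝ≥0∞) (volume.restrict (ball x₀ 2))) := by
    refine eLpNorm_le_of_norm_le_on hD2m hDum hum (s := ball x₀ 2) (fun y hy => ?_) (fun y => ?_) h1r
    · have hy' : y ∉ tsupport (ψ : ℝ³ → ℝ) := by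
        rw [ψ.tsupport_eq]
        exact fun h => hy (closedBall_subset_ball (by norm_num) h)
      rw [iteratedFDeriv_smul_eq_zero_of_notMem hy' 2, norm_zero]
    · rw [norm_norm, hcoe]
      exact norm_iteratedFDeriv_cutoff_smul_le_three (ψ.contDiff (n := 2)) hu2 (hA x₀)
        (Finset.mem_range.2 (by norm_num)) y
  calc eLpNorm (fderiv ℝ u) 3 (volume.restrict (ball x₀ 1))
      ≤ eLpNorm (fderiv ℝ (fun y => ψ y • u y)) 3 volume := hi
    _ ≤ KG * eLpNorm (fderiv ℝ (fderiv ℝ (fun y => ψ y • u y))) ((3 / 2 : ℝ≥0) : ℝ≥0∞) volume := hGNS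
    _ ≤ KG * ((cA : ℝ≥0∞) *
        (eLpNorm (fun x => iteratedFDeriv ℝ 2 u x) ((3 / 2 : ℝ≥0) : ℝ≥0∞) (volume.restrict (ball x₀ 2)) +
          eLpNorm (fun x => fderiv ℝ u x) ((3 / 2 : ℝ≥0) : ℝ≥0∞) (volume.restrict (ball x₀ 2)) +
          eLpNorm u ((3 / 2 : ℝ≥0) : ℝ≥0∞) (volume.restrict (ball x₀ 2)))) := by
        rw [hD2]
        gcongr
    _ = _ := by rw [mul_assoc]

/-- **The Sobolev imbedding `W^{2,2} ⊂ C_B` on balls** (step 5 of the module docstring; Adams 1975,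
Thm 5.4 Part I Case C, localised): there is a finite `K` such that for every `C²` field `u` on
`ℝ³` and every `x₀`, `|u(x₀)| ≤ K (‖D²u‖_{L²(B_{1/2}(x₀))} + ‖Du‖_{L²(B_{1/2}(x₀))} + ‖u‖_{L²(B_{1/2}(x₀))})`:
the tree's whole-space imbedding `FunctionSpaces.exists_enorm_le_sobolev_two_two_dim_three`
applied to `ψ_{x₀} u` for translates `ψ_{x₀}` of one bump (`= 1` at `x₀`, supported in
`B̄_{1/4}(x₀)`), with Leibniz' rule. [cite: Adams1975, Thm. 5.4 Part I Case C (mp > n)] -/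
theorem exists_enorm_le_sobolev_ball :
    ∃ K : ℝ≥0∞, K ≠ ⊤ ∧ ∀ (u : ℝ³ → ℝ³), ContDiff ℝ 2 u → ∀ x₀ : ℝ³,
      ‖u x₀‖ₑ ≤ K * (eLpNorm (fun x => iteratedFDeriv ℝ 2 u x) 2 (volume.restrict (ball x₀ (1 / 2))) +
        eLpNorm (fun x => fderiv ℝ u x) 2 (volume.restrict (ball x₀ (1 / 2))) +
        eLpNorm u 2 (volume.restrict (ball x₀ (1 / 2)))) := by
  obtain ⟨KS, hKS, hSob⟩ := FunctionSpaces.exists_enorm_le_sobolev_two_two_dim_three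
    (E := ℝ³) (F := ℝ³) (volume : Measure ℝ³) finrank_euclideanSpace_fin
  obtain ⟨A, hA0, hA⟩ := exists_bump_bounds (1 / 8) (1 / 4) (by norm_num) (by norm_num)
  set cA : ℝ≥0 := Real.toNNReal (2 * A) with hcA
  have hcoe : ((cA : ℝ≥0) : ℝ) = 2 * A := by rw [hcA, Real.coe_toNNReal _ (by positivity)]
  refine ⟨KS * (3 * cA), ENNReal.mul_ne_top hKS.ne (ENNReal.mul_ne_top (by norm_num) ENNReal.coe_ne_top),
    fun u hu2 x₀ => ?_⟩
  have hum : AEStronglyMeasurable u volume := hu2.continuous.aestronglyMeasurable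
  have hDum : AEStronglyMeasurable (fun x => fderiv ℝ u x) volume :=
    (hu2.continuous_fderiv (by norm_num)).aestronglyMeasurable
  have hD2m : AEStronglyMeasurable (fun x => iteratedFDeriv ℝ 2 u x) volume :=
    (hu2.continuous_iteratedFDeriv le_rfl).aestronglyMeasurable
  set ψ : ContDiffBump x₀ := ⟨1 / 8, 1 / 4, by norm_num, by norm_num⟩ with hψ
  have hgc : ContDiff ℝ 2 (fun y => ψ y • u y) := (ψ.contDiff (n := 2)).smul hu2
  have hg0 : (ψ : ℝ³ → ℝ) x₀ • u x₀ = u x₀ := by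
    rw [ψ.one_of_mem_closedBall (mem_closedBall_self ψ.rIn_pos.le), one_smul]
  have hmain := hSob (fun y => ψ y • u y) hgc x₀
  rw [hg0] at hmain
  refine hmain.trans ?_
  rw [mul_assoc]
  gcongr
  -- `Σ_{j<3} ‖Dʲ(ψu)‖_{L²} ≤ 3 · cA · (…)`
  set S : ℝ≥0∞ := eLpNorm (fun x => iteratedFDeriv ℝ 2 u x) 2 (volume.restrict (ball x₀ (1 / 2))) +
    eLpNorm (fun x => fderiv ℝ u x) 2 (volume.restrict (ball x₀ (1 / 2))) +
    eLpNorm u 2 (volume.restrict (ball x₀ (1 / 2))) with hS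
  have hj : ∀ j ∈ Finset.range 3, eLpNorm (iteratedFDeriv ℝ j (fun y => ψ y • u y)) 2 volume ≤
      (cA : ℝ≥0∞) * S := by
    intro j hj
    have e : eLpNorm (iteratedFDeriv ℝ j (fun y => ψ y • u y)) 2 volume =
        eLpNorm (fun y => ‖iteratedFDeriv ℝ j (fun y => ψ y • u y) y‖) 2 volume :=
      (eLpNorm_norm _).symm
    rw [e]
    refine eLpNorm_le_of_norm_le_on hD2m hDum hum (s := ball x₀ (1 / 2)) (fun y hy => ?_)
      (fun y => ?_) one_le_two
    · have hy' : y ∉ tsupport (ψ : ℝ³ → ℝ) := by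
        rw [ψ.tsupport_eq]
        exact fun h => hy (closedBall_subset_ball (by norm_num) h)
      rw [iteratedFDeriv_smul_eq_zero_of_notMem hy' j, norm_zero]
    · rw [norm_norm, hcoe]
      exact norm_iteratedFDeriv_cutoff_smul_le_three (ψ.contDiff (n := 2)) hu2 (hA x₀) hj y
  calc ∑ j ∈ Finset.range 3, eLpNorm (iteratedFDeriv ℝ j (fun y => ψ y • u y)) 2 volume
      ≤ ∑ _j ∈ Finset.range 3, (cA : ℝ≥0∞) * S := Finset.sum_le_sum hj
    _ = 3 * ↑cA * S := by
        rw [Finset.sum_const, Finset.card_range, nsmul_eq_mul]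
        push_cast
        ring

/-- **Wang 2025, Thm 2.1 / Galdi 2011, Thm X.5.1 — the order-zero velocity clause, PROVED**:
a classical steady solution `(u, p)` of `−Δu + (u·∇)u + ∇p = 0`, `div u = 0` on `ℝ³` with finite
Dirichlet integral and `u ∈ L⁶(ℝ³)` tends to `0` at infinity (Wang p. 30: "`lim_{|x|→∞} |v(x)| = 0`";
= Galdi X.5.1 with `u_∞ = 0`). Route (module docstring): Calderón–Zygmund pressure `p − c = Q ∈ L³`
a.e., interior Stokes estimates with `r = 3/2` then `r = 2` on balls escaping to infinity,
Gagliardo–Nirenberg–Sobolev for the cut-off gradient in between, and the localised imbedding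
`W^{2,2} ⊂ C_B`; every right-hand side is a tail of `∫|u|⁶`, `∫|Du|²` or `∫|Q|³`.
[cite: Wang2025, Thm 2.1 (proof §2.1.3, p. 30)] -/
theorem IsDSolution.tendsto_zero_of_memLp_six {u : ℝ³ → ℝ³} {p : ℝ³ → ℝ}
    (hu : IsDSolution 1 0 u p) (h6 : MemLp u 6 (volume : Measure ℝ³)) :
    Tendsto u (cocompact ℝ³) (𝓝 0) := by
  -- the exponent `3/2`
  set r32 : ℝ≥0∞ := ((3 / 2 : ℝ≥0) : ℝ≥0∞) with hr32
  have hr32_1 : 1 < r32 := by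
    rw [hr32, ← ENNReal.coe_one, ENNReal.coe_lt_coe, ← NNReal.coe_lt_coe]; push_cast; norm_num
  have hr32_top : r32 < ⊤ := ENNReal.coe_lt_top
  have hr32_0 : r32 ≠ 0 := (zero_lt_one.trans hr32_1).ne'
  have hr32_le2 : r32 ≤ 2 := by
    rw [hr32, show (2 : ℝ≥0∞) = ((2 : ℝ≥0) : ℝ≥0∞) by norm_cast, ENNReal.coe_le_coe,
      ← NNReal.coe_le_coe]; push_cast; norm_num
  have hr32_le3 : r32 ≤ 3 := by
    rw [hr32, show (3 : ℝ≥0∞) = ((3 : ℝ≥0) : ℝ≥0∞) by norm_cast, ENNReal.coe_le_coe,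
      ← NNReal.coe_le_coe]; push_cast; norm_num
  have hr32_le6 : r32 ≤ 6 := by
    rw [hr32, show (6 : ℝ≥0∞) = ((6 : ℝ≥0) : ℝ≥0∞) by norm_cast, ENNReal.coe_le_coe,
      ← NNReal.coe_le_coe]; push_cast; norm_num
  haveI hH1 : ENNReal.HolderTriple 2 6 r32 := by
    have h := holderTriple_coe (p := 2) (q := 6) (r := 3 / 2) (by norm_num) (by norm_num) (by norm_num)
      (by push_cast; norm_num)
    simpa [hr32] using h
  haveI hH2 : ENNReal.HolderTriple 3 6 2 := by
    have h := holderTriple_coe (p := 3) (q := 6) (r := 2) (by norm_num) (by norm_num) (by norm_num)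
      (by push_cast; norm_num)
    simpa using h
  -- limit algebra in `ℝ≥0∞`
  have hmul0 : ∀ {F G : ℝ³ → ℝ≥0∞}, Tendsto F (cocompact ℝ³) (𝓝 0) → Tendsto G (cocompact ℝ³) (𝓝 0) →
      Tendsto (fun x₀ => F x₀ * G x₀) (cocompact ℝ³) (𝓝 0) := by
    intro F G hF hG
    have h := ENNReal.Tendsto.mul hF (Or.inr ENNReal.zero_ne_top) hG (Or.inr ENNReal.zero_ne_top)
    rwa [mul_zero] at h
  have hadd0 : ∀ {F G : ℝ³ → ℝ≥0∞}, Tendsto F (cocompact ℝ³) (𝓝 0) → Tendsto G (cocompact ℝ³) (𝓝 0) →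
      Tendsto (fun x₀ => F x₀ + G x₀) (cocompact ℝ³) (𝓝 0) := by
    intro F G hF hG
    have h := hF.add hG
    rwa [add_zero] at h
  have hcmul0 : ∀ {F : ℝ³ → ℝ≥0∞} (K : ℝ≥0∞), K ≠ ⊤ → Tendsto F (cocompact ℝ³) (𝓝 0) →
      Tendsto (fun x₀ => K * F x₀) (cocompact ℝ³) (𝓝 0) := by
    intro F K hK hF
    have h := ENNReal.Tendsto.const_mul hF (Or.inr hK)
    rwa [mul_zero] at h
  have hsq : ∀ {F G : ℝ³ → ℝ≥0∞}, Tendsto G (cocompact ℝ³) (𝓝 0) → (∀ x₀, F x₀ ≤ G x₀) →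
      Tendsto F (cocompact ℝ³) (𝓝 0) := fun hG hle =>
    tendsto_of_tendsto_of_tendsto_of_le_of_le tendsto_const_nhds hG (fun _ => zero_le) hle
  -- §3.0 regularity and data
  have hS := hu.isSteadyNSSolution
  have hprof : IsLerayProfile 1 0 u p := hS.isLerayProfile_zero
  have hu2 : ContDiff ℝ 2 u := hS.contDiff_velocity
  have hu1 : ContDiff ℝ 1 u := hu2.of_le one_le_two
  have huc : Continuous u := hu1.continuous
  have hum : AEStronglyMeasurable u volume := huc.aestronglyMeasurable
  have hDum : AEStronglyMeasurable (fderiv ℝ u) volume :=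
    (hu1.continuous_fderiv one_ne_zero).aestronglyMeasurable
  -- `∫ |u|⁶ < ∞`, `∫ ‖Du‖² < ∞`
  have hIU : ∫⁻ y, ‖u y‖ₑ ^ (6 : ℝ) ≠ ⊤ := by
    have h := h6.eLpNorm_lt_top
    rw [eLpNorm_lt_top_iff_lintegral_rpow_enorm_lt_top (by norm_num) (by norm_num)] at h
    rw [show ((6 : ℝ≥0∞).toReal) = (6 : ℝ) by norm_num] at h
    exact h.ne
  have hIDu : ∫⁻ y, ‖fderiv ℝ u y‖ₑ ^ (2 : ℝ) ≠ ⊤ := by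
    have hpt : ∀ x, ‖fderiv ℝ u x‖ₑ ^ (2 : ℝ) ≤ ENNReal.ofReal (frobeniusNormSq (fderiv ℝ u x)) :=
      fun x => by
        rw [show (2 : ℝ) = ((2 : ℕ) : ℝ) by norm_num, ENNReal.rpow_natCast,
          ← ofReal_norm, ← ENNReal.ofReal_pow (norm_nonneg _)]
        exact ENNReal.ofReal_le_ofReal (norm_sq_le_frobeniusNormSq (fderiv ℝ u x))
    exact (lt_of_le_of_lt (lintegral_mono hpt) hu.dirichlet_lt_top).ne
  -- the Calderón–Zygmund pressure and the constant
  obtain ⟨C, hC⟩ := nrs1996_rieszPressure_holds 3 (by norm_num)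
  have hIU' : ∫⁻ y, ‖u y‖ₑ ^ (2 * (3 : ℝ)) < ⊤ := by
    rw [show (2 * (3 : ℝ)) = 6 by norm_num]
    exact lt_top_iff_ne_top.2 hIU
  obtain ⟨Q, hQm, hQle, hQ⟩ := hC hum hIU'
  have hIQ : ∫⁻ y, ‖Q y‖ₑ ^ (3 : ℝ) ≠ ⊤ :=
    ne_top_of_le_ne_top (ENNReal.mul_ne_top ENNReal.coe_ne_top hIU'.ne) hQle
  obtain ⟨c, hc⟩ := hprof.exists_sub_ae_eq_const_of_lintegral_six hIU hQm hIQ hQ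
  clear hC hQle hIU'
  have hπ1 : ContDiff ℝ 1 (fun x => p x - c) := hS.contDiff_pressure.sub contDiff_const
  have hπm : AEStronglyMeasurable (fun x => p x - c) volume := hπ1.continuous.aestronglyMeasurable
  have hπQ : (fun x => p x - c) =ᵐ[volume] Q := by
    filter_upwards [hc] with x hx
    linarith
  -- the force of the pair `(u, p − c)` is the convective term
  have hforce : (fun x => (1 : ℝ) • (Δ u) x - gradient (fun x => p x - c) x) = convect u u := by
    funext x
    have h0 := hS.momentum x
    simp only [Pi.zero_apply] at h0
    have hg : gradient (fun x => p x - c) x = gradient p x := by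
      rw [gradient, gradient, fderiv_sub_const]
    rw [hg, eq_comm, ← sub_eq_zero, ← h0]
    abel
  have hdivB : ∀ (x₀ : ℝ³) (ρ : ℝ), ∀ x ∈ ball x₀ ρ, VectorCalculus.divergence u x = 0 :=
    fun x₀ ρ x _ => hS.divFree x
  -- §3.1 tails
  have hT6 : ∀ R : ℝ, Tendsto (fun x₀ : ℝ³ => eLpNorm u 6 (volume.restrict (ball x₀ R)))
      (cocompact ℝ³) (𝓝 0) := fun R =>
    tendsto_eLpNorm_ball_cocompact (by norm_num) (by norm_num)
      (by rwa [show ((6 : ℝ≥0∞).toReal) = (6 : ℝ) by norm_num]) R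
  have hT2 : ∀ R : ℝ, Tendsto (fun x₀ : ℝ³ => eLpNorm (fderiv ℝ u) 2 (volume.restrict (ball x₀ R)))
      (cocompact ℝ³) (𝓝 0) := fun R =>
    tendsto_eLpNorm_ball_cocompact (by norm_num) (by norm_num)
      (by rwa [show ((2 : ℝ≥0∞).toReal) = (2 : ℝ) by norm_num]) R
  have hT3 : ∀ R : ℝ, Tendsto (fun x₀ : ℝ³ => eLpNorm (fun x => p x - c) 3 (volume.restrict (ball x₀ R)))
      (cocompact ℝ³) (𝓝 0) := by
    intro R
    have h := tendsto_eLpNorm_ball_cocompact (f := Q) (q := 3) (by norm_num) (by norm_num)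
      (by rwa [show ((3 : ℝ≥0∞).toReal) = (3 : ℝ) by norm_num]) R
    refine h.congr fun x₀ => ?_
    exact (eLpNorm_congr_ae (ae_restrict_of_ae hπQ)).symm
  -- §3.2 first interior estimate: `‖D²u‖_{L^{3/2}(B₂(x₀))} → 0`
  obtain ⟨C₁, hC₁⟩ := stokes_interior_Lr_estimate_ball stokes_interior_Lr_estimate_holds
    one_pos hr32_1 hr32_top (R := 2) two_pos
  have hR1 : Tendsto (fun x₀ : ℝ³ => eLpNorm (fun x => iteratedFDeriv ℝ 2 u x) r32
      (volume.restrict (ball x₀ 2))) (cocompact ℝ³) (𝓝 0) := by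
    have ha : Tendsto (fun x₀ : ℝ³ => eLpNorm (convect u u) r32 (volume.restrict (ball x₀ (2 * 2))))
        (cocompact ℝ³) (𝓝 0) :=
      hsq (hmul0 (hT2 (2 * 2)) (hT6 (2 * 2))) fun x₀ =>
        eLpNorm_convect_le hu1 (volume.restrict (ball x₀ (2 * 2))) 2 6 r32
    have hb : Tendsto (fun x₀ : ℝ³ => eLpNorm u r32 (volume.restrict (ball x₀ (2 * 2))))
        (cocompact ℝ³) (𝓝 0) :=
      tendsto_eLpNorm_ball_of_le hum hr32_0 hr32_le6 (by norm_num) (hT6 (2 * 2))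
    have hc' : Tendsto (fun x₀ : ℝ³ => eLpNorm (fun x => fderiv ℝ u x) r32
        (volume.restrict (ball x₀ (2 * 2)))) (cocompact ℝ³) (𝓝 0) :=
      tendsto_eLpNorm_ball_of_le hDum hr32_0 hr32_le2 (by norm_num) (hT2 (2 * 2))
    have hd : Tendsto (fun x₀ : ℝ³ => eLpNorm (fun x => p x - c) r32 (volume.restrict (ball x₀ (2 * 2))))
        (cocompact ℝ³) (𝓝 0) :=
      tendsto_eLpNorm_ball_of_le hπm hr32_0 hr32_le3 (by norm_num) (hT3 (2 * 2))
    have hrhs := hcmul0 (C₁ : ℝ≥0∞) ENNReal.coe_ne_top (hadd0 (hadd0 (hadd0 ha hb) hc') hd)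
    refine hsq hrhs fun x₀ => ?_
    have h := hC₁ x₀ u (fun x => p x - c) hu2 hπ1 (hdivB x₀ (2 * 2))
    rw [hforce] at h
    exact le_trans le_self_add h
  -- §3.3 Gagliardo–Nirenberg–Sobolev: `‖Du‖_{L³(B₁(x₀))} → 0`
  obtain ⟨KG, hKG, hG⟩ := exists_eLpNorm_fderiv_three_ball_le
  have hR2 : Tendsto (fun x₀ : ℝ³ => eLpNorm (fderiv ℝ u) 3 (volume.restrict (ball x₀ 1)))
      (cocompact ℝ³) (𝓝 0) := by
    have hc' : Tendsto (fun x₀ : ℝ³ => eLpNorm (fun x => fderiv ℝ u x) r32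
        (volume.restrict (ball x₀ 2))) (cocompact ℝ³) (𝓝 0) :=
      tendsto_eLpNorm_ball_of_le hDum hr32_0 hr32_le2 (by norm_num) (hT2 2)
    have hb : Tendsto (fun x₀ : ℝ³ => eLpNorm u r32 (volume.restrict (ball x₀ 2)))
        (cocompact ℝ³) (𝓝 0) :=
      tendsto_eLpNorm_ball_of_le hum hr32_0 hr32_le6 (by norm_num) (hT6 2)
    exact hsq (hcmul0 KG hKG (hadd0 (hadd0 hR1 hc') hb)) fun x₀ => hG u hu2 x₀
  -- §3.4 second interior estimate: `‖D²u‖_{L²(B_{1/2}(x₀))} → 0`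
  obtain ⟨C₂, hC₂⟩ := stokes_interior_Lr_estimate_ball stokes_interior_Lr_estimate_holds
    one_pos (r := 2) (by norm_num) (by norm_num) (R := 1 / 2) (by norm_num)
  have hR3 : Tendsto (fun x₀ : ℝ³ => eLpNorm (fun x => iteratedFDeriv ℝ 2 u x) 2
      (volume.restrict (ball x₀ (1 / 2)))) (cocompact ℝ³) (𝓝 0) := by
    have e21 : (2 * (1 / 2) : ℝ) = 1 := by norm_num
    have ha : Tendsto (fun x₀ : ℝ³ => eLpNorm (convect u u) 2 (volume.restrict (ball x₀ 1)))
        (cocompact ℝ³) (𝓝 0) :=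
      hsq (hmul0 hR2 (hT6 1)) fun x₀ => eLpNorm_convect_le hu1 (volume.restrict (ball x₀ 1)) 3 6 2
    have hb : Tendsto (fun x₀ : ℝ³ => eLpNorm u 2 (volume.restrict (ball x₀ 1)))
        (cocompact ℝ³) (𝓝 0) :=
      tendsto_eLpNorm_ball_of_le hum two_ne_zero (by norm_num) (by norm_num) (hT6 1)
    have hd : Tendsto (fun x₀ : ℝ³ => eLpNorm (fun x => p x - c) 2 (volume.restrict (ball x₀ 1)))
        (cocompact ℝ³) (𝓝 0) :=
      tendsto_eLpNorm_ball_of_le hπm two_ne_zero (by norm_num) (by norm_num) (hT3 1)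
    have hrhs := hcmul0 (C₂ : ℝ≥0∞) ENNReal.coe_ne_top (hadd0 (hadd0 (hadd0 ha hb) (hT2 1)) hd)
    refine hsq hrhs fun x₀ => ?_
    have h := hC₂ x₀ u (fun x => p x - c) hu2 hπ1 (hdivB x₀ (2 * (1 / 2)))
    rw [hforce, e21] at h
    exact le_trans le_self_add h
  -- §3.5 the localised imbedding: `|u(x₀)| → 0`
  obtain ⟨KS, hKS, hSob⟩ := exists_enorm_le_sobolev_ball
  have h0 : Tendsto (fun x₀ : ℝ³ => eLpNorm u 2 (volume.restrict (ball x₀ (1 / 2))))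
      (cocompact ℝ³) (𝓝 0) :=
    tendsto_eLpNorm_ball_of_le hum two_ne_zero (by norm_num : (2 : ℝ≥0∞) ≤ 6) (by norm_num) (hT6 (1 / 2))
  have hen : Tendsto (fun x₀ : ℝ³ => ‖u x₀‖ₑ) (cocompact ℝ³) (𝓝 0) :=
    hsq (hcmul0 KS hKS (hadd0 (hadd0 hR3 (hT2 (1 / 2))) h0)) fun x₀ => hSob u hu2 x₀
  -- conclusion
  rw [tendsto_zero_iff_norm_tendsto_zero]
  have h := (ENNReal.tendsto_toReal ENNReal.zero_ne_top).comp hen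
  rw [ENNReal.toReal_zero] at h
  refine h.congr fun x₀ => ?_
  simp [Function.comp_apply]

end VelocityDecay

/-! ## §4. The discharge -/

/-- **Discharge of `wang2025_thm21_DSolution_uniformDecay`** (W. Wang 2025, Thm 2.1 = G. P. Galdi
2011, Thm X.5.1): for a classical steady solution `(u, p)` of `−Δu + (u·∇)u + ∇p = 0`, `div u = 0`
on `ℝ³` with finite Dirichlet integral and `u ∈ L⁶(ℝ³)` there is `p₁ ∈ ℝ` such that, for every
order `n`, `‖Dⁿu(x)‖ → 0` and `‖Dⁿ(p − p₁)(x)‖ → 0` as `|x| → ∞`. The order-zero velocity clause is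
`IsDSolution.tendsto_zero_of_memLp_six`; all other clauses follow from it
(`wang2025_thm21_DSolution_uniformDecay_of_velocityDecay`, `SteadyDSolutionDerivativeDecay.lean`).
[cite: Wang2025, Thm 2.1 (p. 28; proof §2.1.3, pp. 30–31)] -/
theorem wang2025_thm21_DSolution_uniformDecay_holds : wang2025_thm21_DSolution_uniformDecay :=
  wang2025_thm21_DSolution_uniformDecay_of_velocityDecay fun _ _ hu h6 =>
    hu.tendsto_zero_of_memLp_six h6

end Literature.Analysis.FluidPDE

end
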